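import Summits.BirchSwinnertonDyer.BirchSwinnertonDyer.Theorems.GenusKolyvaginAtTwoShaCardDvdPowAtTwoRTShaFiniteAtTwoTwinShaTrivial
import Summits.BirchSwinnertonDyer.BirchSwinnertonDyer.Theorems.GenusKolyvaginAtTwoShaCardDvdPowAtTwoRTShaFiniteAtTwoRat
import Summits.BirchSwinnertonDyer.BirchSwinnertonDyer.Theorems.GenusKolyvaginAtTwoCasselsTateNumberField
import Literature.Algebra.Module.AlternatingPairingParity
import HarnessLib

/-!
# Route `GenusKolyvaginAtTwo`, crux U_T `ShaCardDvdPowAtTwoRT` (stmt-BirchSwinnertonDyer-23658), LINE 19 `rational_pair_descent` v1.1 —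
# (W1) «A 2-SELMER-MINIMAL TWIN FORCES `w(E) = +1`»: the `W.rootNumber = 1` binder of PAIRCOUNT / SANDWICH′ is DISCHARGED from `#Sel₂(Wd) = 2`

Seat `bsd-line-gk2-p5` g30 (WIDTH-5 attach, cell `bsd-f1-sign2`), `--supports stmt-BirchSwinnertonDyer-23658` (helper; closes nothing).
THEOREMS ONLY (no definition, no named fact, no `sorry`).  BSD is NOT proved by any of this; neither is U_T.

WHY (LEAD memo R7 §1a / §6a): the live stubs of LINE 19 carry `W.rootNumber = 1`; on U_T's frame this is FORCED by the other live hypothesis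
`#Sel₂(Wd) = 2` — so the composition can derive it, the declared residual loses its `w`-conjunct, and the pen's R7-d cut needs no
`W.analyticRank = 0` / `w = 1` binder.

WHAT (frame = U_T's rev-37 binders; Q2 by name; `y_K = P(1)` of infinite order; `Wd` ANY elliptic `ℚ`-model of `E^(d_K)`):
* §1 `forall_two_nsmul_eq_zero_of_odd_torsionOrder`, `natCard_torsionBy_two_eq_one_of_odd_torsionOrder` — odd `#V(F)_tors` ⟹ `V(F)[2] = 0`
  (pure; Cauchy).
* §2 **`rootNumber_eq_one_of_natCard_selmerGroup_twin_eq_two_onHabitat`** — `#Sel₂(Wd) = 2 ⟹ w(E) = +1`.  Road: gk2-p2's (R0)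
  `rankZero_side_of_rootNumber` (Gross 5.3 + `rank E(K) = 1`, gk2-p4 `mordellWeilRank_baseChange_eq_one_onHabitat`) leaves the branch
  `w(E) = −1 ∧ rank Wd(ℚ) = 0 ∧ #Wd(ℚ)_tors odd`; there the descent count `#Sel₂(Wd) = 2^rank · #Wd(ℚ)[2] · #Ш(Wd/ℚ)[2]`
  (`card_selmerGroup_eq_pow_rank_mul`) reads `2 = #Ш(Wd/ℚ)[2]`, while `Ш(Wd/ℚ)[2^∞]` is FINITE on the frame (gk2-p5 g29
  `finite_primaryComponent_sha_twin_two_onHabitat`) so `#Ш(Wd/ℚ)[2]` is a SQUARE by Cassels–Tate (LEAD g13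
  `CasselsTateNumberField.isSquare_natCard_sha_torsionBy_pow`, unconditional in the tree) — and `2` is not a square.
* §3 `hw`-FREE forms of g29's live-configuration lemmas: `mordellWeilRank_rat_eq_zero_and_twin_eq_one_of_selmer_onHabitat`
  (`rank E(ℚ) = 0 ∧ rank Wd(ℚ) = 1`), `forall_primaryComponent_sha_twin_two_eq_zero_of_selmer_onHabitat` (`Ш(Wd/ℚ)[2^∞] = 0`),
  `natCard_primaryComponent_sha_twin_two_eq_one_of_selmer_onHabitat`.

References: [GrossLMS1991] Thm. 1.3, §5 Prop. 5.3; [Kolyvagin1990] Thm. A; [SilvermanAEC2009] Thm. X.4.2, X.4.14, Exercise 10.20;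
[Cassels1962ArithmeticIV] §1; [MazurRubin2010] §1 (2-Selmer-minimal twists); [DokchitserDokchitserMathZ2012] Thm. (1).
-/

set_option autoImplicit false
-- the Theorems namespace of this sub repeats the summit name by design (D-0017 nested layout)
set_option linter.dupNamespace false

noncomputable section

open scoped Classical
open scoped AddSubgroup

namespace Summit.BirchSwinnertonDyer.BirchSwinnertonDyer.Theorems.GenusExact.PlusDescent

open WeierstrassCurve NumberField IsDedekindDomain Field Literature.NumberTheory.EllipticCurves
  Literature.NumberTheory.GaloisRepresentations Literature.NumberTheory.EllipticCurves.ModularForms AddSubgroup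
open Summit.BirchSwinnertonDyer.BirchSwinnertonDyer.Theses.GenusKolyvaginAtTwo (KolyvaginRelationAtTwo)
open Summit.BirchSwinnertonDyer.Rank1Residual

/-! ## §1 Odd torsion order ⟹ no rational `2`-torsion (pure) -/

/-- **Odd `#V(F)_tors` ⟹ `V(F)` has no point of order `2`** (a point `P ≠ 0` with `2P = 0` is a torsion point of order `2`, and the order of
an element divides the order of the finite group `V(F)_tors`). [cite: SilvermanAEC2009, VIII.7] -/
theorem forall_two_nsmul_eq_zero_of_odd_torsionOrder {F : Type*} [Field F] [NumberField F] (V : WeierstrassCurve F) [V.IsElliptic]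
    (hodd : Odd V.torsionOrder) : ∀ P : V.toAffine.Point, 2 • P = 0 → P = 0 := by
  intro P hP
  by_contra hP0
  haveI : Finite (AddCommGroup.torsion V.toAffine.Point) := V.finite_torsion_holds
  haveI : Fact (Nat.Prime 2) := ⟨Nat.prime_two⟩
  have hPt : P ∈ AddCommGroup.torsion V.toAffine.Point :=
    (AddCommGroup.mem_torsion _).mpr ((isOfFinAddOrder_iff_nsmul_eq_zero).mpr ⟨2, two_pos, hP⟩)
  set x : AddCommGroup.torsion V.toAffine.Point := ⟨P, hPt⟩ with hx
  have h2x : 2 • x = 0 := Subtype.ext hP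
  have hx0 : x ≠ 0 := fun h ↦ hP0 (congrArg Subtype.val h)
  have hord : addOrderOf x = 2 := addOrderOf_eq_prime h2x hx0
  have hdvd : 2 ∣ V.torsionOrder := by
    rw [WeierstrassCurve.torsionOrder, ← hord]
    exact addOrderOf_dvd_natCard x
  exact (Nat.not_even_iff_odd.mpr hodd) (even_iff_two_dvd.mpr hdvd)

/-- **Odd `#V(F)_tors` ⟹ `#V(F)[2] = 1`.** [cite: SilvermanAEC2009, VIII.7] -/
theorem natCard_torsionBy_two_eq_one_of_odd_torsionOrder {F : Type*} [Field F] [NumberField F] (V : WeierstrassCurve F)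
    [V.IsElliptic] (hodd : Odd V.torsionOrder) :
    Nat.card (AddSubgroup.torsionBy V.toAffine.Point ((2 : ℕ) : ℤ)) = 1 := by
  have h := forall_two_nsmul_eq_zero_of_odd_torsionOrder V hodd
  rw [Nat.card_eq_one_iff_unique]
  refine ⟨⟨fun a b ↦ Subtype.ext ?_⟩, ⟨0⟩⟩
  rw [h a.1 (torsionBy.nsmul_iff.mp a.2), h b.1 (torsionBy.nsmul_iff.mp b.2)]

/-! ## §2 A 2-Selmer-minimal twin forces `w(E) = +1` -/

/-- **(W1) `#Sel₂(Wd) = 2 ⟹ w(E) = +1` on U_T's frame**, for EVERY elliptic `ℚ`-model `Wd` of the twist `E^(d_K)`.  By (R0)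
(`rankZero_side_of_rootNumber`; Gross Prop. 5.3 `τ y_K + w(E) y_K` torsion, `rank E(K) = 1` by `mordellWeilRank_baseChange_eq_one_onHabitat`,
`rank E(ℚ) + rank E^(d_K)(ℚ) = rank E(K)`) the alternative to `w(E) = 1` is `w(E) = −1 ∧ rank Wd(ℚ) = 0 ∧ #Wd(ℚ)_tors` odd; then the descent
count (AEC X.4.2, `card_selmerGroup_eq_pow_rank_mul`) gives `#Ш(Wd/ℚ)[2] = #Sel₂(Wd) = 2`, but `Ш(Wd/ℚ)[2^∞]` is finite on the frame
(`finite_primaryComponent_sha_twin_two_onHabitat`), so `#Ш(Wd/ℚ)[2]` is a square (Cassels–Tate, `CasselsTateNumberField.isSquare_natCard_sha_torsionBy_pow`),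
and `2` is not.  Discharges the `W.rootNumber = 1` binder of LINE 19's live stubs from their `#Sel₂(Wd) = 2` binder (LEAD memo R7 §1a/§6a).
[cite: GrossLMS1991, Thm. 1.3, §5 Prop. 5.3] [cite: SilvermanAEC2009, Thm. X.4.2 (a), Thm. X.4.14] [cite: Cassels1962ArithmeticIV, §1]
[cite: MazurRubin2010, §1] -/
theorem rootNumber_eq_one_of_natCard_selmerGroup_twin_eq_two_onHabitat (hQ2 : KolyvaginRelationAtTwo)
    (W : WeierstrassCurve ℚ) [W.IsElliptic] [W.IsGloballyMinimal] [NeZero (W.conductorNorm ℤ)] (hcm : ¬ W.HasCM)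
    (hT : Odd W.tamagawaProduct) (v : HeightOneSpectrum (𝓞 ℚ)) (h2v : ((2 : ℕ) : 𝓞 ℚ) ∉ v.asIdeal)
    (hNv : ((W.conductorNorm ℤ : ℕ) : 𝓞 ℚ) ∈ v.asIdeal) (hmult : W.HasMultiplicativeReductionAt v) (hneg : W.Δ < 0)
    (K : Type) [Field K] [NumberField K] (hIQ : IsImaginaryQuadratic K) (hodd : Odd (NumberField.discr K))
    (h3 : NumberField.discr K ≠ -3) (hHe : SatisfiesHeegnerHypothesis (W.conductorNorm ℤ) K)
    (hsq1 : ¬ IsSquare ((NumberField.discr K : ℚ) * -|W.Δ|)) (hsq2 : ¬ IsSquare ((NumberField.discr K : ℚ) * (-(2 * |W.Δ|))))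
    (hρ : ∀ n : ℕ, 0 < n → W.HasSurjectiveModNGaloisRep ((2 : ℤ) ^ n))
    (Dt : ModularParametrizationData W (W.conductorNorm ℤ)) (β : ℤ) (ι : K →+* ℂ) (d₁ : KolyvaginHeegnerData Dt β ι 1)
    (hnt : ¬ IsOfFinAddOrder d₁.derivedPoint) (M₀ : ℕ)
    (hndiv : ¬ ∃ Q : (W.baseChange (ringClassField K ι 1)).toAffine.Point, ((2 ^ (M₀ + 1) : ℕ) : ℤ) • Q = d₁.derivedPoint)
    (Wd : WeierstrassCurve ℚ) [Wd.IsElliptic] (hWd : ∃ C : VariableChange ℚ, C • W.quadraticTwist (NumberField.discr K : ℚ) = Wd)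
    (hSel : Nat.card (Wd.selmerGroup 2) = 2) :
    W.rootNumber = 1 := by
  haveI : Fact (Nat.Prime 2) := ⟨Nat.prime_two⟩
  have hs2 : W.HasSurjectiveModNGaloisRep 2 := by simpa using hρ 1 one_pos
  -- `rank E(K) = 1`
  have hrk := mordellWeilRank_baseChange_eq_one_onHabitat hQ2 W hcm hT v h2v hNv hmult hneg K hIQ hodd h3 hHe hsq1 hsq2 hρ Dt β ι d₁ hnt
    M₀ hndiv
  -- the `K`-rational Heegner point under `P(1)`, of infinite order
  obtain ⟨P₀, hHP, hP₀⟩ := AdditiveKoly.exists_isHeegnerPoint_map_eq_derivedPoint_one (W := W) (K := K) (Dt := Dt) (β := β) (ι := ι)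
    hIQ hHe d₁
  have hP₀nt : ¬ IsOfFinAddOrder P₀ := fun h ↦ hnt (by rw [← hP₀]; exact AddMonoidHom.isOfFinAddOrder _ h)
  -- (R0): either `w = 1`, or `w = −1` with `rank Wd(ℚ) = 0` and odd torsion
  rcases rankZero_side_of_rootNumber K W hIQ hHe hs2 hrk hHP hP₀nt (Wd := Wd) hWd with ⟨hw, -, -⟩ | ⟨-, hrk0, htor⟩
  · exact hw
  exfalso
  -- `Ш(Wd/ℚ)[2^∞]` finite ⟹ `#(Ш(Wd/ℚ) ∩ H¹(ℚ,Wd)[2])` is a square (Cassels–Tate)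
  haveI := finite_primaryComponent_sha_twin_two_onHabitat hQ2 W hcm hT v h2v hNv hmult hneg K hIQ hodd h3 hHe hsq1 hsq2 hρ Dt β ι d₁ M₀
    hndiv Wd hWd
  have hsq : IsSquare (Nat.card (Wd.sha ⊓ AddSubgroup.torsionBy Wd.galH1 ((2 : ℕ) : ℤ) : AddSubgroup Wd.galH1)) := by
    have h := CasselsTateNumberField.isSquare_natCard_sha_torsionBy_pow Wd 2 1
    rwa [pow_one, Literature.Algebra.Module.natCard_torsionBy_addSubgroup] at h
  -- the descent count: `2 = 2^0 · 1 · #(Ш ∩ H¹[2])`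
  have hcount := card_selmerGroup_eq_pow_rank_mul Wd 2
  rw [hrk0, pow_zero, one_mul, natCard_torsionBy_two_eq_one_of_odd_torsionOrder Wd htor, one_mul] at hcount
  simp only [Nat.cast_ofNat] at hcount hSel hsq
  rw [← hcount, hSel] at hsq
  -- `2` is not a square
  exact Nat.prime_two.prime.not_isSquare hsq

/-! ## §3 `hw`-free forms of the live-configuration lemmas -/

/-- **`rank E(ℚ) = 0` and `rank Wd(ℚ) = 1` on U_T's frame under a 2-Selmer-minimal twin**, WITHOUT the `w(E) = +1` binder (§2 + g29's
`mordellWeilRank_rat_eq_zero_and_twin_eq_one_onHabitat`). [cite: GrossLMS1991, Thm. 1.3, §5 Prop. 5.3] [cite: Kolyvagin1990, Thm. A] -/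
theorem mordellWeilRank_rat_eq_zero_and_twin_eq_one_of_selmer_onHabitat (hQ2 : KolyvaginRelationAtTwo)
    (W : WeierstrassCurve ℚ) [W.IsElliptic] [W.IsGloballyMinimal] [NeZero (W.conductorNorm ℤ)] (hcm : ¬ W.HasCM)
    (hT : Odd W.tamagawaProduct) (v : HeightOneSpectrum (𝓞 ℚ)) (h2v : ((2 : ℕ) : 𝓞 ℚ) ∉ v.asIdeal)
    (hNv : ((W.conductorNorm ℤ : ℕ) : 𝓞 ℚ) ∈ v.asIdeal) (hmult : W.HasMultiplicativeReductionAt v) (hneg : W.Δ < 0)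
    (K : Type) [Field K] [NumberField K] (hIQ : IsImaginaryQuadratic K) (hodd : Odd (NumberField.discr K))
    (h3 : NumberField.discr K ≠ -3) (hHe : SatisfiesHeegnerHypothesis (W.conductorNorm ℤ) K)
    (hsq1 : ¬ IsSquare ((NumberField.discr K : ℚ) * -|W.Δ|)) (hsq2 : ¬ IsSquare ((NumberField.discr K : ℚ) * (-(2 * |W.Δ|))))
    (hρ : ∀ n : ℕ, 0 < n → W.HasSurjectiveModNGaloisRep ((2 : ℤ) ^ n))
    (Dt : ModularParametrizationData W (W.conductorNorm ℤ)) (β : ℤ) (ι : K →+* ℂ) (d₁ : KolyvaginHeegnerData Dt β ι 1)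
    (hnt : ¬ IsOfFinAddOrder d₁.derivedPoint) (M₀ : ℕ)
    (hndiv : ¬ ∃ Q : (W.baseChange (ringClassField K ι 1)).toAffine.Point, ((2 ^ (M₀ + 1) : ℕ) : ℤ) • Q = d₁.derivedPoint)
    (Wd : WeierstrassCurve ℚ) [Wd.IsElliptic] (hWd : ∃ C : VariableChange ℚ, C • W.quadraticTwist (NumberField.discr K : ℚ) = Wd)
    (hSel : Nat.card (Wd.selmerGroup 2) = 2) :
    W.mordellWeilRank = 0 ∧ Wd.mordellWeilRank = 1 :=
  mordellWeilRank_rat_eq_zero_and_twin_eq_one_onHabitat hQ2 W hcm hT v h2v hNv hmult hneg K hIQ hodd h3 hHe hsq1 hsq2 hρ Dt β ι d₁ hnt M₀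
    hndiv (rootNumber_eq_one_of_natCard_selmerGroup_twin_eq_two_onHabitat hQ2 W hcm hT v h2v hNv hmult hneg K hIQ hodd h3 hHe hsq1 hsq2 hρ
      Dt β ι d₁ hnt M₀ hndiv Wd hWd hSel) Wd hWd

/-- **`Ш(Wd/ℚ)[2^∞] = 0` on U_T's frame under a 2-Selmer-minimal twin**, WITHOUT the `w(E) = +1` binder (§2 + g29's
`forall_primaryComponent_sha_twin_two_eq_zero_onHabitat`). [cite: SilvermanAEC2009, Thm. X.4.2 (a)] [cite: MazurRubin2010, §1] -/
theorem forall_primaryComponent_sha_twin_two_eq_zero_of_selmer_onHabitat (hQ2 : KolyvaginRelationAtTwo)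
    (W : WeierstrassCurve ℚ) [W.IsElliptic] [W.IsGloballyMinimal] [NeZero (W.conductorNorm ℤ)] (hcm : ¬ W.HasCM)
    (hT : Odd W.tamagawaProduct) (v : HeightOneSpectrum (𝓞 ℚ)) (h2v : ((2 : ℕ) : 𝓞 ℚ) ∉ v.asIdeal)
    (hNv : ((W.conductorNorm ℤ : ℕ) : 𝓞 ℚ) ∈ v.asIdeal) (hmult : W.HasMultiplicativeReductionAt v) (hneg : W.Δ < 0)
    (K : Type) [Field K] [NumberField K] (hIQ : IsImaginaryQuadratic K) (hodd : Odd (NumberField.discr K))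
    (h3 : NumberField.discr K ≠ -3) (hHe : SatisfiesHeegnerHypothesis (W.conductorNorm ℤ) K)
    (hsq1 : ¬ IsSquare ((NumberField.discr K : ℚ) * -|W.Δ|)) (hsq2 : ¬ IsSquare ((NumberField.discr K : ℚ) * (-(2 * |W.Δ|))))
    (hρ : ∀ n : ℕ, 0 < n → W.HasSurjectiveModNGaloisRep ((2 : ℤ) ^ n))
    (Dt : ModularParametrizationData W (W.conductorNorm ℤ)) (β : ℤ) (ι : K →+* ℂ) (d₁ : KolyvaginHeegnerData Dt β ι 1)
    (hnt : ¬ IsOfFinAddOrder d₁.derivedPoint) (M₀ : ℕ)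
    (hndiv : ¬ ∃ Q : (W.baseChange (ringClassField K ι 1)).toAffine.Point, ((2 ^ (M₀ + 1) : ℕ) : ℤ) • Q = d₁.derivedPoint)
    (Wd : WeierstrassCurve ℚ) [Wd.IsElliptic] (hWd : ∃ C : VariableChange ℚ, C • W.quadraticTwist (NumberField.discr K : ℚ) = Wd)
    (hSel : Nat.card (Wd.selmerGroup 2) = 2) :
    ∀ x ∈ AddCommGroup.primaryComponent Wd.sha 2, x = 0 :=
  forall_primaryComponent_sha_twin_two_eq_zero_onHabitat hQ2 W hcm hT v h2v hNv hmult hneg K hIQ hodd h3 hHe hsq1 hsq2 hρ Dt β ι d₁ hnt M₀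
    hndiv (rootNumber_eq_one_of_natCard_selmerGroup_twin_eq_two_onHabitat hQ2 W hcm hT v h2v hNv hmult hneg K hIQ hodd h3 hHe hsq1 hsq2 hρ
      Dt β ι d₁ hnt M₀ hndiv Wd hWd hSel) Wd hWd hSel

/-- **`#Ш(Wd/ℚ)[2^∞] = 1` on U_T's frame under a 2-Selmer-minimal twin**, WITHOUT the `w(E) = +1` binder.
[cite: SilvermanAEC2009, Thm. X.4.2 (a)] [cite: MazurRubin2010, §1] -/
theorem natCard_primaryComponent_sha_twin_two_eq_one_of_selmer_onHabitat (hQ2 : KolyvaginRelationAtTwo)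
    (W : WeierstrassCurve ℚ) [W.IsElliptic] [W.IsGloballyMinimal] [NeZero (W.conductorNorm ℤ)] (hcm : ¬ W.HasCM)
    (hT : Odd W.tamagawaProduct) (v : HeightOneSpectrum (𝓞 ℚ)) (h2v : ((2 : ℕ) : 𝓞 ℚ) ∉ v.asIdeal)
    (hNv : ((W.conductorNorm ℤ : ℕ) : 𝓞 ℚ) ∈ v.asIdeal) (hmult : W.HasMultiplicativeReductionAt v) (hneg : W.Δ < 0)
    (K : Type) [Field K] [NumberField K] (hIQ : IsImaginaryQuadratic K) (hodd : Odd (NumberField.discr K))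
    (h3 : NumberField.discr K ≠ -3) (hHe : SatisfiesHeegnerHypothesis (W.conductorNorm ℤ) K)
    (hsq1 : ¬ IsSquare ((NumberField.discr K : ℚ) * -|W.Δ|)) (hsq2 : ¬ IsSquare ((NumberField.discr K : ℚ) * (-(2 * |W.Δ|))))
    (hρ : ∀ n : ℕ, 0 < n → W.HasSurjectiveModNGaloisRep ((2 : ℤ) ^ n))
    (Dt : ModularParametrizationData W (W.conductorNorm ℤ)) (β : ℤ) (ι : K →+* ℂ) (d₁ : KolyvaginHeegnerData Dt β ι 1)
    (hnt : ¬ IsOfFinAddOrder d₁.derivedPoint) (M₀ : ℕ)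
    (hndiv : ¬ ∃ Q : (W.baseChange (ringClassField K ι 1)).toAffine.Point, ((2 ^ (M₀ + 1) : ℕ) : ℤ) • Q = d₁.derivedPoint)
    (Wd : WeierstrassCurve ℚ) [Wd.IsElliptic] (hWd : ∃ C : VariableChange ℚ, C • W.quadraticTwist (NumberField.discr K : ℚ) = Wd)
    (hSel : Nat.card (Wd.selmerGroup 2) = 2) :
    Nat.card (AddCommGroup.primaryComponent Wd.sha 2) = 1 :=
  natCard_primaryComponent_sha_twin_two_eq_one_onHabitat hQ2 W hcm hT v h2v hNv hmult hneg K hIQ hodd h3 hHe hsq1 hsq2 hρ Dt β ι d₁ hnt M₀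
    hndiv (rootNumber_eq_one_of_natCard_selmerGroup_twin_eq_two_onHabitat hQ2 W hcm hT v h2v hNv hmult hneg K hIQ hodd h3 hHe hsq1 hsq2 hρ
      Dt β ι d₁ hnt M₀ hndiv Wd hWd hSel) Wd hWd hSel

end Summit.BirchSwinnertonDyer.BirchSwinnertonDyer.Theorems.GenusExact.PlusDescent

end
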